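import Summits.QuantumFields.QCD.Theses.WilsonMobilityGap
import Literature.Barriers.QuantumFields.WilsonDeterminantSign

/-!
# Crux `MobilityGap` (stmt-QuantumFields-9150), line `Ideator6Sketch`, stub `stub_unitaryMatching` (S2):
# the deterministic skeleton of the sea = valence fixed point — connectedness of the bare-mass interval

Fragment for `stub_unitaryMatching` (S2, "the bet" of card `integer-pinch-unitary-point`).  The card locates
the unitary (Aoki) point `x_u` — a bare mass at which the `|det D_W(x)|^{N_f}`-reweighted kernel
`Γ₅ D_W(U, m₀, 1)` is delocalised AT ITS OWN SEA MASS `m₀ = x` — by an intermediate-value argument for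
`g(x) = m₀*_max(x) - x` over the (sea mass, valence mass) plane.  Written out, that argument only ever looks
at the DIAGONAL `m₀ = x` (the honest / phase-quenched `N_f`-flavour theory at bare mass `x`), and it consumes
exactly the following inputs about the predicate `P x` := "at bare mass `x` the theory's own Hermitian
Wilson–Dirac kernel obeys a volume-uniform fractional-moment bound at `E = 0`" and an integer `ch x`
(disorder-averaged second Chern number of its Fermi projection) — NOT the non-uniformity statement
`ValenceDelocalisationPQ` that the skeleton feeds into S2:

* (THE BET, with the index principle riding on it) localisation is an OPEN condition in the bare mass and the
  index is locally constant on the localised set: `P x → ∀ᶠ t in 𝓝 x, P t ∧ ch t = ch x` for `x ∈ [-1, 1]`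
  — continuity of the infinite-volume law `x ↦ μ_{β,x}` in a topology transporting volume-uniform FM bounds,
  i.e. no first-order transition in the bare mass at weak coupling (true in the Aoki scenario, false in the
  Sharpe–Singleton scenario `c₂ < 0` of `Literature.Barriers.QuantumFields.AokiPhaseDichotomy`), plus
  Aizenman–Graf / Prodan–Schulz-Baldes constancy of the Chern number along a mobility gap;
* (the pocket, S1a at the corner) `P (-1)`, with pocket value `ch(-1) = -3`;
* (the trivial plateau, deterministic) `P x` for `0 < x ≤ 1`, with `ch = 0` there; so `ch(-1) ≠ ch(1)`.

Then `[-1, 1]` cannot lie inside the localised set: on it `ch` would be a continuous map into the discrete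
space `ℤ` on a preconnected interval, hence constant.  The exit point lies in `(-1, 0]`.  This file proves
that step for an arbitrary predicate and integer assignment (`unitaryPoint_of_locallyConstantIndex`), and
its two-parameter (sea, valence) form over an open localised set in `ℝ × ℝ`
(`unitaryPoint_of_locallyConstantIndex₂`), so that the lead can instantiate `P x` / `Loc x m₀` with the
reweighted FM bound of the skeleton verbatim (`¬ P x` is then literally S2's conclusion at the coupling in
hand).  Pure topology (Mathlib: `isPreconnected_Icc`, `IsPreconnected.constant`); no physics input is
proved here.
-/

noncomputable section

namespace Summit.QuantumFields.QCD.Theorems.MobilityGapPinch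

open scoped BigOperators Topology
open MeasureTheory Filter Set Matrix Complex
open Literature.MathematicalPhysics.QuantumFieldTheory Literature.MathematicalPhysics.QuantumLattice
  Literature.Probability.LatticeModels Literature.Barriers.QuantumFields.WilsonDeterminant

/-- **The unitary point from a locally constant index (connectedness of the bare-mass interval).**
Let `P` be any predicate on bare masses ("localised at `E = 0` under its own sea") and `ch : ℝ → ℤ` an
integer assignment such that, at every localised `x ∈ [-1, 1]`, nearby masses are localised with the same
index (`P x → ∀ᶠ t in 𝓝 x, P t ∧ ch t = ch x`: localisation is open in the bare mass and the index is
locally constant on it — the bet).  If the pocket corner `-1` is localised, the index differs at the two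
ends, `ch(-1) ≠ ch(1)`, and every `0 < x ≤ 1` is localised (trivial plateau), then some `x ∈ (-1, 0]` is NOT
localised — the sea = valence delocalised bare mass `x_u` of stub S2.  Proof: otherwise `ch` is continuous
into the discrete space `ℤ` on the preconnected interval `[-1, 1]`, hence constant there. -/
theorem unitaryPoint_of_locallyConstantIndex : ∀ (P : ℝ → Prop) (ch : ℝ → ℤ),
    (∀ x : ℝ, -1 ≤ x → x ≤ 1 → P x → ∀ᶠ t in nhds x, P t ∧ ch t = ch x) →
    P (-1) → ch (-1) ≠ ch 1 → (∀ x : ℝ, 0 < x → x ≤ 1 → P x) →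
    ∃ x : ℝ, -1 < x ∧ x ≤ 0 ∧ ¬ P x := by
  intro P ch hloc hpocket hjump htriv
  by_contra h
  push Not at h
  -- every point of `[-1, 1]` is localised
  have hall : ∀ x ∈ Icc (-1 : ℝ) 1, P x := by
    intro x hx
    rcases eq_or_lt_of_le hx.1 with h1 | h1
    · rw [← h1]; exact hpocket
    rcases le_or_gt x 0 with h0 | h0
    · exact h x h1 h0
    · exact htriv x h0 hx.2
  -- the index is continuous into `ℤ` on `[-1, 1]`
  have hcont : ContinuousOn ch (Icc (-1 : ℝ) 1) := by
    intro x hx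
    have hev : ∀ᶠ t in 𝓝 x, ch t = ch x := (hloc x hx.1 hx.2 (hall x hx)).mono fun t ht => ht.2
    have hca : ContinuousAt ch x := (continuousAt_const (y := ch x)).congr (hev.mono fun t ht => ht.symm)
    exact hca.continuousWithinAt
  -- hence constant on the preconnected interval: contradiction with the jump
  have hmem1 : (-1 : ℝ) ∈ Icc (-1 : ℝ) 1 := ⟨le_rfl, by norm_num⟩
  have hmem2 : (1 : ℝ) ∈ Icc (-1 : ℝ) 1 := ⟨by norm_num, le_rfl⟩
  exact hjump (isPreconnected_Icc.constant hcont hmem1 hmem2)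

/-- **Two-parameter form (sea mass `x`, valence mass `m₀`).**  Let `Loc x m₀` be any predicate on
(sea, valence) pairs whose truth set is open in `ℝ × ℝ` (the bet: continuity of the sea law in `x`, jointly
with openness in the valence mass), and `Ch : ℝ → ℝ → ℤ` an integer assignment locally constant on that set
relative to it (index principle in `m₀` at fixed sea; the bet again in `x`).  If the pocket corner
`(-1, -1)` is localised, `Ch(-1,-1) ≠ Ch(1,1)`, and the diagonal is localised for `0 < x ≤ 1` (trivial
plateau), then some diagonal point `(x, x)`, `-1 < x ≤ 0`, is not localised.  Restriction of
`unitaryPoint_of_locallyConstantIndex` to the diagonal `x ↦ (x, x)`. -/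
theorem unitaryPoint_of_locallyConstantIndex₂ (Loc : ℝ → ℝ → Prop) (Ch : ℝ → ℝ → ℤ)
    (hopen : IsOpen {p : ℝ × ℝ | Loc p.1 p.2})
    (hconst : ∀ p : ℝ × ℝ, Loc p.1 p.2 → ∀ᶠ q in 𝓝[{p : ℝ × ℝ | Loc p.1 p.2}] p, Ch q.1 q.2 = Ch p.1 p.2)
    (hpocket : Loc (-1) (-1)) (hjump : Ch (-1) (-1) ≠ Ch 1 1) (htriv : ∀ x : ℝ, 0 < x → x ≤ 1 → Loc x x) :
    ∃ x : ℝ, -1 < x ∧ x ≤ 0 ∧ ¬ Loc x x := by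
  refine unitaryPoint_of_locallyConstantIndex (fun x => Loc x x) (fun x => Ch x x) ?_ hpocket hjump htriv
  intro x _ _ hL
  have hdiag : Continuous fun t : ℝ => ((t, t) : ℝ × ℝ) := continuous_id.prodMk continuous_id
  have hmem : ∀ᶠ t in 𝓝 x, ((t, t) : ℝ × ℝ) ∈ {p : ℝ × ℝ | Loc p.1 p.2} :=
    hdiag.tendsto x (hopen.mem_nhds hL)
  have hnhds : Tendsto (fun t : ℝ => ((t, t) : ℝ × ℝ)) (𝓝 x) (𝓝[{p : ℝ × ℝ | Loc p.1 p.2}] (x, x)) :=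
    tendsto_nhdsWithin_iff.mpr ⟨hdiag.tendsto x, hmem⟩
  have hev : ∀ᶠ t in 𝓝 x, Ch t t = Ch x x := hnhds.eventually (hconst (x, x) hL)
  exact hmem.and hev

end Summit.QuantumFields.QCD.Theorems.MobilityGapPinch

end
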